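/-
Copyright: the b2b-balaban cell (near-miss cell 7), T⁴-continuum fan-out, NE7b ROUND-2 swarm `t4-ne7b-formalise-*`
(seat leaf-10, gen 4), supplier module for row S6g′-INSTANCE piece T3c «lattice-animal factor» (owner's ruling
R-OWNER-22-23) of lineage t4-ne7b-p1's claim table `LEAVES-NE7b.md`.
Released under the licence of the surrounding project.
-/
import Literature.MathematicalPhysics.QuantumFieldTheory.Balaban1983to89.TreeLength
import Literature.MathematicalPhysics.QuantumFieldTheory.Balaban1983to89.B12Ext436Lattice
import Literature.Probability.LatticeModels.LatticeAnimals

/-!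
# Region templates: the lattice-animal factor of the NE7b placement count

Summits-side support leaf of the T⁴-continuum cell (rung (B)+1 on a FINITE torus only; NOT infinite volume, NOT the
mass gap, NOT the Clay statement; NOT a proof of the spine estimate NE7b).  Row S6g′-INSTANCE, piece **T3c** of the
owner's ruling R-OWNER-22-23 («lattice-animal factor `#{r} ≤ ∏_births A_d(fat+1) ≤ exp(θ_a·bsum(1+fat))`»), filed as a
SUPPLIER module for the instance seat (leaf-05 g3), which consumes it BY NAME in T3a∕T3b; the TREE half (products
over the births of a genealogy in the `HistoryJoins.bsum` currency, address bridge) is the sibling module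
`HistoryBirthMenus`, generic in the per-birth menu — plug `T := Templates d` with `card_templates_le_exp` ∕
`one_le_card_templates` below.  [folklore] finite combinatorics on the swarm's OWN index model `Pt d = ℤ^d`
(`B13ScaleTransfer.{Pt, Adj, FaceConnected}`), composed BY NAME with two tree lemmas that carry their own citations: the lattice-animal count `Literature.Probability.LatticeModels.card_connectedFamily_le`
([FriedliVelenik2017] Lemma 3.38 ∕ (5.27)) on the wall adjacency of ℤ^d (`B12Ext436Lattice.{nbrZ, card_nbrZ_le,
isRConnected_of_faceConnected}`, `Δ = 2d`), and the volume bound `TreeLength.card_le_treeLen`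
(`#Z ≤ 2^d(4·treeLen Z + 1)`, [Balaban1988RG2Cluster] (2.30) lower half, repaired form).  Nothing is quoted from the
audited series and nothing printed is asserted: B16 p. 384's sentence «exp O(1)(MR_j)^{−d}|Z_j|» is only LOCATED as
the place where print pays this factor; no `[cite:]` tag, no `Prop` fact minted, constants SYMBOLIC (trigger c6).

WHY.  Under the owner's wiring (α′) the multiplicity of a slot `(x, G)` is estimated by injecting the histories read
into it into pairs (template assignment `r`, admissible placement `p` of the sorted twin), T3b; the count `#S` runs
for a FIXED region template per birth, T3a; and the number of template assignments is paid OUTSIDE `#S` — per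
birth of fatness `f` a factor `#(Templates d f) ≤ exp(thetaA d·(f+1))` (this file), in total
`HistoryBirthMenus.mprod (Templates d) fat G ≤ exp(thetaA d · bsum (fat + 1) G)` (class-linear in the exits' letter).

WHAT.
* §1 translations of ℤ^d preserve wall adjacency, chains and face-connectedness (`adj_add_right`,
  `linked_image_add`, `faceConnected_image_add`).
* §2 templates of cell budget `n` (`0 ∈ Z`, face-connected, `#Z ≤ n`); **`card_le_of_template`**: any finite family
  of them has `≤ (2d+1)^{2n}` members (the tree's animal count at `Δ = 2d`); hence the templates form a FINITE set and
  **`Templates d f : Finset (Finset (Pt d))`** — the templates of cell budget **`tcap d f = 2^d(4f+1)`** — is a genuine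
  finset with box-free membership (`mem_templates_iff`), containing `{0}`; no `Prop`-valued definition is introduced.
* §3 **`image_sub_mem_templates`**: a REALISED birth region (`z ∈ Z`, `FaceConnected Z`, `treeLen Z ≤ f` — verbatim the
  output of leaf-07 g2's `HistoryZonesOrbitRealise.births_facts_of_corr`) translated by its anchor IS a template of
  budget `f`; `image_sub_image_add` recovers the region from (anchor, template), so «history ↦ (anchors, templates)»
  forgets nothing.
* §4 the count: **`card_templates_le : #(Templates d f) ≤ animalConst d ^ (f+1)`**, `animalConst d = (2d+1)^{2^{d+3}}`;
  real form **`card_templates_le_exp`** with **`thetaA d = log (animalConst d)`** (`thetaA_nonneg`); finset-indexed products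
  `prod_card_templates_le_exp`, `card_pi_templates_le_exp` (`Finset.card_pi`).
* §5 sanity (decided).

HONEST DEPENDENCY (cell, verbatim): continuum YM on T⁴ ⇐ BetaPertH ∧ nine spine estimates (0/9 proved); BetaPertH ⇐
(D1) ∧ (D4) ∧ CAP+tail; G-an2-4 gates asym, D1 and NE2/3/4.  This file changes none of it; `BirthShapeNodup` is not
retired by it; NE7b NOT proved.
-/

open Finset
open Literature.MathematicalPhysics.QuantumFieldTheory.Balaban1983to89
open Literature.MathematicalPhysics.QuantumFieldTheory.Balaban1983to89.B13ScaleTransfer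
open Literature.MathematicalPhysics.QuantumFieldTheory.Balaban1983to89.TreeLength
open Literature.MathematicalPhysics.QuantumFieldTheory.Balaban1983to89.B12Ext436Lattice
  (nbrZ mem_nbrZ card_nbrZ_le isRConnected_of_faceConnected)
open Literature.Probability.LatticeModels (card_connectedFamily_le)

namespace Summit.QuantumFields.BalabanUV.T4Continuum.HistoryRegionTemplates

noncomputable section

variable {d : ℕ}

/-! ## §1 Translations of ℤ^d -/

/-- wall adjacency is translation invariant [folklore] -/
theorem adj_add_right {x y : Pt d} (h : Adj x y) (v : Pt d) : Adj (x + v) (y + v) := by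
  obtain ⟨i, h | h⟩ := h
  · refine ⟨i, Or.inl ?_⟩
    rw [h]
    funext j
    by_cases hj : j = i
    · subst hj; simp [add_right_comm]
    · simp [hj]
  · refine ⟨i, Or.inr ?_⟩
    rw [h]
    funext j
    by_cases hj : j = i
    · subst hj; simp [add_right_comm]
    · simp [hj]

/-- chains of cubes translate [folklore] -/
theorem linked_image_add {S : Finset (Pt d)} {x y : Pt d} (h : Linked S x y) (v : Pt d) :
    Linked (S.image (· + v)) (x + v) (y + v) := by
  unfold Linked at *
  induction h with
  | refl => exact Relation.ReflTransGen.refl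
  | tail _ hbc ih =>
    exact Relation.ReflTransGen.tail ih
      ⟨mem_image_of_mem (· + v) hbc.1, mem_image_of_mem (· + v) hbc.2.1, adj_add_right hbc.2.2 v⟩

/-- face-connectedness is translation invariant [folklore] -/
theorem faceConnected_image_add {S : Finset (Pt d)} (h : FaceConnected S) (v : Pt d) :
    FaceConnected (S.image (· + v)) := by
  intro x hx y hy
  obtain ⟨a, ha, rfl⟩ := mem_image.1 hx
  obtain ⟨b, hb, rfl⟩ := mem_image.1 hy
  exact linked_image_add (h a ha b hb) v

/-- `x ↦ x − z` is `x ↦ x + (−z)` [folklore] -/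
theorem sub_eq_add_neg_fun (z : Pt d) : (fun x : Pt d => x - z) = fun x => x + -z := by
  funext x; exact sub_eq_add_neg x z

/-- **RECOVERY**: translating the anchored template back by the anchor gives the region. [folklore] -/
theorem image_sub_image_add (S : Finset (Pt d)) (z : Pt d) : (S.image (· - z)).image (· + z) = S := by
  rw [sub_eq_add_neg_fun, image_image]
  convert image_id (s := S) using 2
  funext x
  simp

/-! ## §2 Templates -/

/-- **THE ANIMAL COUNT FOR TEMPLATES.**  A TEMPLATE of cell budget `n` is a face-connected finite family of cubes of
ℤ^d through the origin with at most `n` cubes; any finite family of them has at most `(2d+1)^{2n}` members (the tree's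
`card_connectedFamily_le` on the wall adjacency of ℤ^d, `Δ = 2d`). [folklore] -/
theorem card_le_of_template {n : ℕ} (𝒯 : Finset (Finset (Pt d)))
    (h : ∀ Z ∈ 𝒯, (0 : Pt d) ∈ Z ∧ FaceConnected Z ∧ Z.card ≤ n) : 𝒯.card ≤ (2 * d + 1) ^ (2 * n) := by
  refine card_connectedFamily_le (R := Adj) (nbr := nbrZ) (fun _ _ h => h.symm) card_nbrZ_le
    (fun _ _ h => mem_nbrZ h) 0 n 𝒯 fun Z hZ => ?_
  obtain ⟨h0, hc, hcard⟩ := h Z hZ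
  exact ⟨h0, hcard.trans (Nat.le_succ n), (isRConnected_of_faceConnected ⟨0, h0⟩ hc).2 0 h0⟩

/-- the templates of a given budget form a finite set [folklore] -/
theorem finite_setOf_template (d n : ℕ) :
    {Z : Finset (Pt d) | (0 : Pt d) ∈ Z ∧ FaceConnected Z ∧ Z.card ≤ n}.Finite := by
  by_contra hinf
  obtain ⟨t, ht, hcard⟩ := Set.Infinite.exists_subset_card_eq hinf ((2 * d + 1) ^ (2 * n) + 1)
  have hle := card_le_of_template t fun Z hZ => ht (mem_coe.2 hZ)
  omega

/-- **CELL BUDGET OF A FAT-`f` REGION**: `2^d(4f+1)` (`TreeLength.card_le_treeLen`). [folklore] -/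
def tcap (d f : ℕ) : ℕ := 2 ^ d * (4 * f + 1)

/-- `1 ≤ tcap` [folklore] -/
theorem one_le_tcap (d f : ℕ) : 1 ≤ tcap d f :=
  Nat.one_le_iff_ne_zero.2 (by unfold tcap; positivity)

/-- **THE TEMPLATES OF FATNESS `f`**: the finite set of face-connected `Z ∋ 0` of ℤ^d with `#Z ≤ 2^d(4f+1)`. [folklore] -/
def Templates (d f : ℕ) : Finset (Finset (Pt d)) := (finite_setOf_template d (tcap d f)).toFinset

/-- membership in `Templates` (box-free) [folklore] -/
theorem mem_templates_iff {f : ℕ} {Z : Finset (Pt d)} :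
    Z ∈ Templates d f ↔ (0 : Pt d) ∈ Z ∧ FaceConnected Z ∧ Z.card ≤ tcap d f := by
  rw [Templates, Set.Finite.mem_toFinset]
  rfl

/-- the one-cube template [folklore] -/
theorem singleton_zero_mem_templates (d f : ℕ) : ({0} : Finset (Pt d)) ∈ Templates d f := by
  refine mem_templates_iff.2 ⟨mem_singleton_self _, fun x hx y hy => ?_, by simpa using one_le_tcap d f⟩
  rw [mem_singleton] at hx hy
  subst hx; subst hy
  exact Relation.ReflTransGen.refl

/-- `Templates` is non-empty [folklore] -/
theorem templates_nonempty (d f : ℕ) : (Templates d f).Nonempty := ⟨{0}, singleton_zero_mem_templates d f⟩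

/-- `1 ≤ #Templates` [folklore] -/
theorem one_le_card_templates (d f : ℕ) : 1 ≤ (Templates d f).card := card_pos.2 (templates_nonempty d f)

/-! ## §3 Realised regions are anchored templates -/

/-- a non-empty face-connected region of tree length `≤ f` has at most `tcap d f` cubes [folklore] -/
theorem card_le_tcap_of_treeLen {Z : Finset (Pt d)} (hne : Z.Nonempty) (hc : FaceConnected Z) {f : ℕ}
    (hl : treeLen Z ≤ (f : ℝ)) : Z.card ≤ tcap d f := by
  have h := card_le_treeLen hne hc
  have h2 : (0 : ℝ) ≤ 2 ^ d := by positivity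
  have h3 : (Z.card : ℝ) ≤ 2 ^ d * (4 * (f : ℝ) + 1) := h.trans (by nlinarith)
  have h4 : (Z.card : ℝ) ≤ (tcap d f : ℝ) := by simpa [tcap] using h3
  exact_mod_cast h4

/-- **A REALISED BIRTH REGION, TRANSLATED BY ITS ANCHOR, IS A TEMPLATE OF ITS FATNESS**: `z ∈ Z`, `FaceConnected Z`,
`treeLen Z ≤ f` ⇒ `Z.image (· − z) ∈ Templates d f`. [folklore] -/
theorem image_sub_mem_templates {Z : Finset (Pt d)} {z : Pt d} (hz : z ∈ Z) (hc : FaceConnected Z) {f : ℕ}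
    (hl : treeLen Z ≤ (f : ℝ)) : Z.image (· - z) ∈ Templates d f := by
  rw [sub_eq_add_neg_fun]
  refine mem_templates_iff.2 ⟨?_, faceConnected_image_add hc (-z), ?_⟩
  · exact mem_image.2 ⟨z, hz, by simp⟩
  · rw [card_image_of_injective _ (add_left_injective (-z))]
    exact card_le_tcap_of_treeLen ⟨z, hz⟩ hc hl

/-- the anchored pair `(z, Z.image (· − z))` determines the region: injectivity of «region ↦ (anchor, template)» on
regions with a chosen anchor [folklore] -/
theorem eq_of_image_sub_eq {Z Z' : Finset (Pt d)} {z : Pt d} (h : Z.image (· - z) = Z'.image (· - z)) : Z = Z' := by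
  rw [← image_sub_image_add Z z, ← image_sub_image_add Z' z, h]

/-! ## §4 The count -/

/-- **THE ANIMAL CONSTANT** `(2d+1)^{2^{d+3}}` (symbolic; trigger c6). [folklore] -/
def animalConst (d : ℕ) : ℕ := (2 * d + 1) ^ (2 ^ (d + 3))

/-- `1 ≤ animalConst` [folklore] -/
theorem one_le_animalConst (d : ℕ) : 1 ≤ animalConst d := Nat.one_le_pow _ _ (by omega)

/-- exponent bookkeeping: `2·tcap d f ≤ 2^{d+3}(f+1)` [folklore] -/
theorem two_mul_tcap_le (d f : ℕ) : 2 * tcap d f ≤ 2 ^ (d + 3) * (f + 1) := by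
  have h : 2 ^ (d + 3) = 2 ^ d * 8 := by rw [pow_add]; norm_num
  rw [h, tcap]
  have := Nat.one_le_two_pow (n := d)
  nlinarith

/-- **THE TEMPLATE COUNT**: `#(Templates d f) ≤ animalConst d ^ (f+1)`. [folklore] -/
theorem card_templates_le (d f : ℕ) : (Templates d f).card ≤ animalConst d ^ (f + 1) := by
  calc (Templates d f).card ≤ (2 * d + 1) ^ (2 * tcap d f) :=
        card_le_of_template _ fun Z hZ => mem_templates_iff.1 hZ
    _ ≤ (2 * d + 1) ^ (2 ^ (d + 3) * (f + 1)) := Nat.pow_le_pow_right (by omega) (two_mul_tcap_le d f)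
    _ = animalConst d ^ (f + 1) := by rw [animalConst, pow_mul]

/-- **THE ANIMAL RATE** `thetaA d = log (animalConst d)` (`= 2^{d+3}·log(2d+1)`). [folklore] -/
def thetaA (d : ℕ) : ℝ := Real.log (animalConst d)

/-- `0 ≤ thetaA` [folklore] -/
theorem thetaA_nonneg (d : ℕ) : 0 ≤ thetaA d :=
  Real.log_nonneg (by exact_mod_cast one_le_animalConst d)

/-- `exp (thetaA d) = animalConst d` [folklore] -/
theorem exp_thetaA (d : ℕ) : Real.exp (thetaA d) = (animalConst d : ℝ) :=
  Real.exp_log (by exact_mod_cast Nat.lt_of_lt_of_le Nat.zero_lt_one (one_le_animalConst d))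

/-- `animalConst ^ (f+1) = exp(thetaA·(f+1))` [folklore] -/
theorem pow_animalConst_eq_exp (d f : ℕ) : ((animalConst d : ℝ)) ^ (f + 1) = Real.exp (thetaA d * ((f : ℝ) + 1)) := by
  rw [← exp_thetaA, ← Real.exp_nat_mul]
  push_cast
  ring_nf

/-- **THE TEMPLATE COUNT, EXPONENTIAL FORM**: `#(Templates d f) ≤ exp(thetaA d·(f+1))`. [folklore] -/
theorem card_templates_le_exp (d f : ℕ) : ((Templates d f).card : ℝ) ≤ Real.exp (thetaA d * ((f : ℝ) + 1)) := by
  rw [← pow_animalConst_eq_exp]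
  exact_mod_cast card_templates_le d f

/-- **PRODUCTS OVER A FINSET OF BIRTH DATA**: `∏_{i ∈ I} #(Templates d (f i)) ≤ exp(thetaA d · Σ_{i ∈ I} (f i + 1))`.
[folklore] -/
theorem prod_card_templates_le_exp {ι : Type*} (I : Finset ι) (f : ι → ℕ) :
    (∏ i ∈ I, ((Templates d (f i)).card : ℝ)) ≤ Real.exp (thetaA d * ∑ i ∈ I, ((f i : ℝ) + 1)) := by
  rw [mul_sum, Real.exp_sum]
  exact prod_le_prod (fun i _ => by positivity) fun i _ => card_templates_le_exp d (f i)

/-- the finset of template assignments indexed by `I` (`Finset.pi`) has `∏ #Templates` members, hence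
`≤ exp(thetaA d · Σ_{i ∈ I} (f i + 1))` [folklore] -/
theorem card_pi_templates_le_exp {ι : Type*} [DecidableEq ι] (I : Finset ι) (f : ι → ℕ) :
    (((I.pi fun i => Templates d (f i)).card : ℕ) : ℝ) ≤ Real.exp (thetaA d * ∑ i ∈ I, ((f i : ℝ) + 1)) := by
  rw [Finset.card_pi]
  push_cast
  exact prod_card_templates_le_exp I f

/-! ## §5 Sanity (decided toy instances) -/

namespace Sanity

/-- in `d = 1` the budget of a fat-`2` region is `2·9 = 18` cubes -/
example : tcap 1 2 = 18 := by decide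

/-- the animal constant in `d = 1` is `3^16` -/
example : animalConst 1 = 3 ^ 16 := by decide

/-- the translated pair `{(3,3),(3,4)}` anchored at `(3,3)` is the template `{0, e₂}` -/
example : (({![3, 3], ![3, 4]} : Finset (Pt 2)).image (· - ![3, 3])) = {0, ![0, 1]} := by decide

end Sanity

end

end Summit.QuantumFields.BalabanUV.T4Continuum.HistoryRegionTemplates
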